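import Mathlib.Data.Nat.Pairing
import Literature.Computability.MetaComplexity.LanguageCompression
import Literature.Computability.MetaComplexity.UPSearchBricks
import Literature.Computability.MetaComplexity.ParamUniformPadding
import Literature.Computability.Complexity.GoldwasserSipserRefereeBricks
import Literature.Computability.Complexity.LengthCompare
import Literature.Computability.Complexity.StringEquality
import HarnessLib

/-!
# Complexity meta: the verifier of the Goldwasser–Sipser lower-bound language for the slices `L_t` (Hirahara 2021, Lemma 4.5), I: pieces

Topic `Literature/Computability/MetaComplexity`, part of the inline proof plan of
`Hirahara2021_languageCompression` (S. Hirahara, ECCC TR21-058 (2021)): Lemma 4.5 (p. 26, proof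
pp. 27–28) estimates `|L_t|` for an `NP` ensemble `L = {L_t}` through the `NP` language
"`L' := {(r, 1^{⟨t,k⟩}) | ∃ y ∈ {0,1}^{p(t)}, V((1ᵗ, 2ᵏ), y, r) = 1}`" of the amplified Goldwasser–Sipser
lower bound protocol (Lemma 4.6). This file writes, in the tree's algebra of `FP` bricks, the
verifier's PIECE for one basic test — "item `j` of the certificate is a member of `L_t` (with its
certificate) hashed to `0^{κ+1}` by block `j` of the coins" — and its value on records:

* layout: instance `v = (r, 1^{⟨t,κ⟩})`, certificate `W = ⟨1ᵗ, ⟨1^κ, items⟩⟩` with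
  `items = encList [item₀, …]`, `item_j = ⟨y_j, c_j⟩`; coins `r` cut into blocks of
  `B(t, κ) = (κ+1)(M(t)+1)` bits, `M(t) = p_L(t) + 1` (members are padded to length `M(t)` by the
  `10*` padding `Plumb.pad10Fn`); the hash of a block is `Stockmeyer.coinHash`, tested by `GSRef.hashOkFn`;
* `SLB.pieceF R pL pL'` — the one-symbol piece `⟨⟨v, W⟩, 1ʲ⟩ ↦ [1]` if item `j` is valid (`|y_j| ≤ p_L(t)`,
  `pad(y_j)` hashes to zero under block `j`, `c_j` certifies `(y_j, 1ᵗ) ∈ L` for the verifier `(R, p_L')`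
  of `L`), `ε` otherwise (`pieceF_apply`, `pieceF_mem_FP`, `length_pieceF_le`);
* `SLB.lenParams`: `M`, `B`, `u(t) = 128(t+1)` tests, threshold `θ(t) = 40(t+1) = (5/16) u(t)`.

The verifier proper (the fold counting valid pieces, `runFold appF pieceF`, and the language) is in
`SliceLowerBoundNP.lean`.

## References

* S. Hirahara, ECCC TR21-058 (2021), Lemma 4.5, Lemma 4.6 and their proofs (pp. 26–28) [Hirahara2021].
* S. Arora, B. Barak, *Computational Complexity: A Modern Approach*, CUP 2009, §8.2.2 (set lower
  bound protocol), §1.3 [AroraBarakCC2009].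
-/

noncomputable section

namespace Literature.Computability.MetaComplexity

open _root_.Computability Polynomial Complexity Complexity.Classes Complexity.Brick Complexity.Plumb
  Complexity.HashBricks Complexity.LenCmp Complexity.Stockmeyer

namespace SLB

open scoped Classical

/-! ### The lengths -/

/-- Padded member length `M(t) = p_L(t) + 1`. [folklore] -/
def memLen (pL : Polynomial ℕ) (t : ℕ) : ℕ := pL.eval t + 1

/-- Block length `B(t, κ) = (κ + 1)(M(t) + 1)` (the coins of one affine hash `{0,1}^{M} → {0,1}^{κ+1}`). [folklore] -/
def blkLen (pL : Polynomial ℕ) (t κ : ℕ) : ℕ := (κ + 1) * (memLen pL t + 1)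

/-- Number of basic tests `u(t) = 128(t+1)` (so that `exp(-u/128) = e^{-(t+1)} < 2^{-t}`). [folklore] -/
def tests (t : ℕ) : ℕ := 128 * (t + 1)

/-- Acceptance threshold `θ(t) = 40(t+1) = (5/16) u(t)`. [folklore] -/
def thresh (t : ℕ) : ℕ := 40 * (t + 1)

/-- `θ(t) = (5/16) u(t)` in `ℝ`. [folklore] -/
theorem thresh_eq (t : ℕ) : (thresh t : ℝ) = 5 / 16 * (tests t : ℕ) := by
  simp [thresh, tests]; ring

/-- `u(t) ≥ 1`. [folklore] -/
theorem tests_pos (t : ℕ) : 0 < tests t := by unfold tests; omega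

/-- The `10*` padding of a member: `pad P y = y 1 0^{P - |y|}` (the value of `Plumb.pad10Fn`; twin of
`Cryptography.LenPres.pad` / `Barriers.PneNP.Wilson.pad`, which live in files this one should not import).
[cite: AroraBarakCC2009, §1.2 (padding)] -/
def pad (P : ℕ) (y : List Bool) : List Bool := y ++ true :: List.replicate (P - y.length) false

/-- A padded member of length `≤ P` has length `P + 1`. [folklore] -/
theorem length_pad {P : ℕ} {y : List Bool} (hy : y.length ≤ P) : (pad P y).length = P + 1 := by
  simp [pad]; omega

/-- Reading back the last `1`: dropping the trailing zeros of a reversed padded string. [folklore] -/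
theorem dropWhile_replicate_false (n : ℕ) (l : List Bool) :
    ((List.replicate n false ++ true :: l).dropWhile fun b => b == false) = true :: l := by
  induction n with
  | zero => simp
  | succ n _ => simp [List.replicate_succ]

/-- The padding is injective (read back the last `1`). [folklore] -/
theorem pad_injective {P : ℕ} {y y' : List Bool} (h : pad P y = pad P y') : y = y' := by
  have key : ∀ (z : List Bool) (n : ℕ),
      ((z ++ true :: List.replicate n false).reverse.dropWhile fun b => b == false) = true :: z.reverse := by
    intro z n
    rw [List.reverse_append, List.reverse_cons, List.reverse_replicate, List.append_assoc, List.singleton_append,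
      dropWhile_replicate_false]
  have h1 := congr_arg (fun l : List Bool => (l.reverse.dropWhile fun b => b == false)) h
  simp only [pad, key] at h1
  exact List.reverse_injective (List.cons.inj h1).2

/-! ### Parsers

The piece's argument is `ζ = ⟨w, 1ʲ⟩` with `w = ⟨v, W⟩`, `v = ⟨r, 1^m⟩`, `W = ⟨1ᵗ, ⟨1^κ, items⟩⟩`. All
parsers are total (`boolUnpair`). -/

/-- `1ʲ`. [folklore] -/
def jU : List Bool → List Bool := sndF
/-- `w = ⟨v, W⟩`. [folklore] -/
def wF : List Bool → List Bool := fstF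
/-- `r`. [folklore] -/
def rF : List Bool → List Bool := fstF ∘ fstF ∘ wF
/-- `W`. [folklore] -/
def WF : List Bool → List Bool := sndF ∘ wF
/-- `1ᵗ` (normalised). [folklore] -/
def tU : List Bool → List Bool := onesFn ∘ fstF ∘ WF
/-- `1^κ` (normalised). [folklore] -/
def kU : List Bool → List Bool := onesFn ∘ fstF ∘ sndF ∘ WF
/-- `items`. [folklore] -/
def itemsF : List Bool → List Bool := sndF ∘ sndF ∘ WF
/-- `item_j`. [folklore] -/
def itemF : List Bool → List Bool := nthItemFn ∘ fanoutFn jU itemsF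
/-- `y_j`. [folklore] -/
def yF : List Bool → List Bool := fstF ∘ itemF
/-- `c_j`. [folklore] -/
def cF : List Bool → List Bool := sndF ∘ itemF

variable (pL : Polynomial ℕ)

/-- `1^{p_L(t)}`. [folklore] -/
def PU : List Bool → List Bool := polyFn pL ∘ tU
/-- `1^{M(t)}`. [folklore] -/
def MU : List Bool → List Bool := List.cons true ∘ PU pL
/-- `1^{B(t, κ)}`. [folklore] -/
def BU : List Bool → List Bool := umulFn ∘ fanoutFn (List.cons true ∘ kU) (List.cons true ∘ MU pL)
/-- Block `j` of the coins: `(r ⇂ jB) ↾ B`. [folklore] -/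
def blockF : List Bool → List Bool := takeFn ∘ fanoutFn (BU pL) (dropFn ∘ fanoutFn (umulFn ∘ fanoutFn jU (BU pL)) rF)
/-- The padded member `pad (p_L(t)) y_j`. [folklore] -/
def padF : List Bool → List Bool := pad10Fn ∘ fanoutFn (PU pL) yF
/-- The instance `(y_j, 1ᵗ)` of `L`. [folklore] -/
def instF : List Bool → List Bool := fanoutFn yF tU

variable (rTest : List Bool → List Bool) (pL' : Polynomial ℕ)

/-- **The validity test of item `j`**: `|y_j| ≤ p_L(t)`, `pad(y_j)` hashes to `0^{κ+1}` under block `j`,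
`⟨(y_j, 1ᵗ), c_j⟩ ∈ R` and `|c_j| ≤ p_L'(|(y_j, 1ᵗ)|)`. [cite: Hirahara2021, Lemma 4.6 (proof sketch: "sends y with h(y) = 0 and (y, x) ∈ L together with a certificate")] -/
def validF : List Bool → List Bool :=
  andFn (lenLeFn pL ∘ fanoutFn tU yF)
  (andFn (GSRef.hashOkFn ∘ fanoutFn (blockF pL) (fanoutFn (MU pL) (fanoutFn (List.cons true ∘ kU) (padF pL))))
  (andFn (rTest ∘ fanoutFn (instF) cF)
    (lenLeFn pL' ∘ fanoutFn instF cF)))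

/-- **The piece**: `[1]` if item `j` is valid, `ε` otherwise. [cite: Hirahara2021, Lemma 4.5 (proof, the language L')] -/
def pieceF : List Bool → List Bool := iteFn (validF pL rTest pL') (fun _ => [true]) fun _ => []

variable {pL rTest pL'}

/-! ### Values on records -/

section Values

variable (r : List Bool) (m t κ : ℕ) (items : List Bool) (j : ℕ)

/-- The argument record of piece `j`. [folklore] -/
def arg : List Bool :=
  boolPair (boolPair (paramEnc (r, m)) (boolPair (ones t) (boolPair (ones κ) items))) (ones j)


/-- `1ʲ` of the record. [folklore] -/
theorem jU_arg : jU (arg r m t κ items j) = ones j := by simp [jU, arg]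
/-- `r` of the record. [folklore] -/
theorem rF_arg : rF (arg r m t κ items j) = r := by simp [rF, wF, arg, paramEnc]
/-- `1ᵗ` of the record. [folklore] -/
theorem tU_arg : tU (arg r m t κ items j) = ones t := by simp [tU, WF, wF, arg, onesFn, ParamUniform.unaryEncodeNat_eq_ones]
/-- `1^κ` of the record. [folklore] -/
theorem kU_arg : kU (arg r m t κ items j) = ones κ := by simp [kU, WF, wF, arg, onesFn, ParamUniform.unaryEncodeNat_eq_ones]
/-- `items` of the record. [folklore] -/
theorem itemsF_arg : itemsF (arg r m t κ items j) = items := by simp [itemsF, WF, wF, arg]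
/-- `item_j` of the record. [folklore] -/
theorem itemF_arg : itemF (arg r m t κ items j) = nthItemFn (boolPair (ones j) items) := by
  simp [itemF, fanoutFn_apply, jU_arg, itemsF_arg]
/-- `1^{p_L(t)}` of the record. [folklore] -/
theorem PU_arg : PU pL (arg r m t κ items j) = ones (pL.eval t) := by
  rw [PU, Function.comp_apply, tU_arg, polyFn_apply, ParamUniform.length_ones]
/-- `1^{M(t)}` of the record. [folklore] -/
theorem MU_arg : MU pL (arg r m t κ items j) = ones (memLen pL t) := by
  rw [MU, Function.comp_apply, PU_arg]; simp [ones, memLen, List.replicate_succ]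
/-- `1^{B(t,κ)}` of the record. [folklore] -/
theorem BU_arg : BU pL (arg r m t κ items j) = ones (blkLen pL t κ) := by
  rw [BU, Function.comp_apply, fanoutFn_apply, Function.comp_apply, kU_arg, Function.comp_apply, MU_arg,
    show true :: ones κ = ones (κ + 1) by simp [ones, List.replicate_succ],
    show true :: ones (memLen pL t) = ones (memLen pL t + 1) by simp [ones, List.replicate_succ], umulFn_boolPair, blkLen]
/-- Block `j` of the coins of the record. [folklore] -/
theorem blockF_arg : blockF pL (arg r m t κ items j) = (r.drop (j * blkLen pL t κ)).take (blkLen pL t κ) := by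
  rw [blockF, Function.comp_apply, fanoutFn_apply, BU_arg, Function.comp_apply, fanoutFn_apply, Function.comp_apply,
    fanoutFn_apply, jU_arg, BU_arg, umulFn_boolPair, rF_arg, dropFn_boolPair, takeFn_boolPair, ParamUniform.length_ones, ParamUniform.length_ones]

end Values

/-- **Value of the validity test** of item `j` on a record (any `items` string; `y = (item_j).1`,
`c = (item_j).2`). [cite: Hirahara2021, Lemma 4.6 (proof sketch)] -/
theorem validF_arg {R : Language Bool} (hr : ∀ v, rTest v = [R.boolIndicator v]) (r : List Bool) (m t κ : ℕ)
    (items : List Bool) (j : ℕ) :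
    validF pL rTest pL' (arg r m t κ items j) =
      [decide ((fstF (nthItemFn (boolPair (ones j) items))).length ≤ pL.eval t ∧
        HashesToZero ((r.drop (j * blkLen pL t κ)).take (blkLen pL t κ)) (memLen pL t) (κ + 1)
          (pad (pL.eval t) (fstF (nthItemFn (boolPair (ones j) items)))) ∧
        boolPair (paramEnc (fstF (nthItemFn (boolPair (ones j) items)), t)) (sndF (nthItemFn (boolPair (ones j) items))) ∈ R ∧
        (sndF (nthItemFn (boolPair (ones j) items))).length ≤
          pL'.eval (paramEnc (fstF (nthItemFn (boolPair (ones j) items)), t)).length)] := by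
  set ζ := arg r m t κ items j with hζ
  set y := fstF (nthItemFn (boolPair (ones j) items)) with hy
  set c := sndF (nthItemFn (boolPair (ones j) items)) with hc
  have hyF : yF ζ = y := by rw [yF, Function.comp_apply, itemF_arg]
  have hcF : cF ζ = c := by rw [cF, Function.comp_apply, itemF_arg]
  have hinst : instF ζ = paramEnc (y, t) := by rw [instF, fanoutFn_apply, hyF, tU_arg, paramEnc, ParamUniform.unaryEncodeNat_eq_ones]
  have hpad : padF pL ζ = pad (pL.eval t) y := by
    rw [padF, Function.comp_apply, fanoutFn_apply, PU_arg, hyF, pad10Fn_boolPair, pad]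
  have c1 : (lenLeFn pL ∘ fanoutFn tU yF) ζ = [decide (y.length ≤ pL.eval t)] := by
    rw [Function.comp_apply, fanoutFn_apply, tU_arg, hyF, lenLeFn_boolPair, ParamUniform.length_ones]
  have c2 : (GSRef.hashOkFn ∘ fanoutFn (blockF pL) (fanoutFn (MU pL) (fanoutFn (List.cons true ∘ kU) (padF pL)))) ζ =
      [decide (HashesToZero ((r.drop (j * blkLen pL t κ)).take (blkLen pL t κ)) (memLen pL t) (κ + 1) (pad (pL.eval t) y))] := by
    rw [Function.comp_apply, fanoutFn_apply, fanoutFn_apply, fanoutFn_apply, Function.comp_apply, blockF_arg, MU_arg, kU_arg, hpad,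
      show true :: ones κ = ones (κ + 1) by simp [ones, List.replicate_succ]]
    by_cases h : HashesToZero ((r.drop (j * blkLen pL t κ)).take (blkLen pL t κ)) (memLen pL t) (κ + 1) (pad (pL.eval t) y)
    · rw [(GSRef.hashOkFn_eq_true_iff _ _ _ _).2 h, decide_eq_true h]
    · obtain ⟨b, hb⟩ := GSRef.oneBit_hashOkFn (boolPair ((r.drop (j * blkLen pL t κ)).take (blkLen pL t κ))
        (boolPair (ones (memLen pL t)) (boolPair (ones (κ + 1)) (pad (pL.eval t) y))))
      cases b with
      | true => exact absurd ((GSRef.hashOkFn_eq_true_iff _ _ _ _).1 hb) h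
      | false => rw [hb, decide_eq_false h]
  have c3 : (rTest ∘ fanoutFn instF cF) ζ = [R.boolIndicator (boolPair (paramEnc (y, t)) c)] := by
    rw [Function.comp_apply, fanoutFn_apply, hinst, hcF, hr]
  have c4 : (lenLeFn pL' ∘ fanoutFn instF cF) ζ = [decide (c.length ≤ pL'.eval (paramEnc (y, t)).length)] := by
    rw [Function.comp_apply, fanoutFn_apply, hinst, hcF, lenLeFn_boolPair]
  unfold validF
  rw [andFn_apply c1 (andFn_apply c2 (andFn_apply c3 c4))]
  by_cases hm : boolPair (paramEnc (y, t)) c ∈ R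
  · rw [(Set.mem_iff_boolIndicator _ _).1 hm]; simp [hm]
  · rw [(Set.notMem_iff_boolIndicator _ _).1 hm]; simp [hm]

/-- **Value of the piece**: `[1]` or `ε` according to validity. [cite: Hirahara2021, Lemma 4.5 (proof)] -/
theorem pieceF_arg {R : Language Bool} (hr : ∀ v, rTest v = [R.boolIndicator v]) (r : List Bool) (m t κ : ℕ)
    (items : List Bool) (j : ℕ) (V : Prop) [Decidable V]
    (hV : V ↔ ((fstF (nthItemFn (boolPair (ones j) items))).length ≤ pL.eval t ∧
        HashesToZero ((r.drop (j * blkLen pL t κ)).take (blkLen pL t κ)) (memLen pL t) (κ + 1)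
          (pad (pL.eval t) (fstF (nthItemFn (boolPair (ones j) items)))) ∧
        boolPair (paramEnc (fstF (nthItemFn (boolPair (ones j) items)), t)) (sndF (nthItemFn (boolPair (ones j) items))) ∈ R ∧
        (sndF (nthItemFn (boolPair (ones j) items))).length ≤
          pL'.eval (paramEnc (fstF (nthItemFn (boolPair (ones j) items)), t)).length)) :
    pieceF pL rTest pL' (arg r m t κ items j) = if V then [true] else [] := by
  unfold pieceF
  rw [iteFn_apply (validF_arg hr r m t κ items j)]
  by_cases h : V
  · rw [if_pos h, decide_eq_true (hV.1 h)]; rfl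
  · rw [if_neg h, decide_eq_false (fun h' => h (hV.2 h'))]; rfl

/-! ### Polynomial time -/

/-- The parsers are in `FP`. [folklore] -/
theorem parsers_mem_FP : rF ∈ FP ∧ tU ∈ FP ∧ kU ∈ FP ∧ itemsF ∈ FP ∧ itemF ∈ FP ∧ yF ∈ FP ∧ cF ∈ FP := by
  have hw : wF ∈ FP := fstF_mem_FP
  have hW : WF ∈ FP := comp_mem_FP sndF_mem_FP hw
  have hr : rF ∈ FP := comp_mem_FP fstF_mem_FP (comp_mem_FP fstF_mem_FP hw)
  have ht : tU ∈ FP := comp_mem_FP onesFn_mem_FP (comp_mem_FP fstF_mem_FP hW)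
  have hk : kU ∈ FP := comp_mem_FP onesFn_mem_FP (comp_mem_FP fstF_mem_FP (comp_mem_FP sndF_mem_FP hW))
  have hi : itemsF ∈ FP := comp_mem_FP sndF_mem_FP (comp_mem_FP sndF_mem_FP hW)
  have hit : itemF ∈ FP := comp_mem_FP nthItemFn_mem_FP (fanoutFn_mem_FP sndF_mem_FP hi)
  exact ⟨hr, ht, hk, hi, hit, comp_mem_FP fstF_mem_FP hit, comp_mem_FP sndF_mem_FP hit⟩

/-- **The validity test is in `FP`** when the membership test of `R` is. [cite: AroraBarakCC2009, §1.3] -/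
theorem validF_mem_FP (hrT : rTest ∈ FP) : validF pL rTest pL' ∈ FP := by
  obtain ⟨hr, ht, hk, -, -, hy, hc⟩ := parsers_mem_FP
  have hP : PU pL ∈ FP := comp_mem_FP (polyFn_mem_FP pL) ht
  have hM : MU pL ∈ FP := comp_mem_FP (cons_mem_FP true) hP
  have hk1 : List.cons true ∘ kU ∈ FP := comp_mem_FP (cons_mem_FP true) hk
  have hB : BU pL ∈ FP := comp_mem_FP umulFn_mem_FP (fanoutFn_mem_FP hk1 (comp_mem_FP (cons_mem_FP true) hM))
  have hblk : blockF pL ∈ FP := comp_mem_FP takeFn_mem_FP (fanoutFn_mem_FP hB (comp_mem_FP dropFn_mem_FP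
    (fanoutFn_mem_FP (comp_mem_FP umulFn_mem_FP (fanoutFn_mem_FP sndF_mem_FP hB)) hr)))
  have hpad : padF pL ∈ FP := comp_mem_FP pad10Fn_mem_FP (fanoutFn_mem_FP hP hy)
  have hinst : instF ∈ FP := fanoutFn_mem_FP hy ht
  have h1 : lenLeFn pL ∘ fanoutFn tU yF ∈ FP := comp_mem_FP (lenLeFn_mem_FP pL) (fanoutFn_mem_FP ht hy)
  have h2 : GSRef.hashOkFn ∘ fanoutFn (blockF pL) (fanoutFn (MU pL) (fanoutFn (List.cons true ∘ kU) (padF pL))) ∈ FP :=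
    comp_mem_FP GSRef.hashOkFn_mem_FP (fanoutFn_mem_FP hblk (fanoutFn_mem_FP hM (fanoutFn_mem_FP hk1 hpad)))
  have h3 : rTest ∘ fanoutFn instF cF ∈ FP := comp_mem_FP hrT (fanoutFn_mem_FP hinst hc)
  have h4 : lenLeFn pL' ∘ fanoutFn instF cF ∈ FP := comp_mem_FP (lenLeFn_mem_FP pL') (fanoutFn_mem_FP hinst hc)
  exact andFn_mem_FP h1 (andFn_mem_FP h2 (andFn_mem_FP h3 h4))

/-- **The piece is in `FP`.** [cite: AroraBarakCC2009, §1.3] -/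
theorem pieceF_mem_FP (hrT : rTest ∈ FP) : pieceF pL rTest pL' ∈ FP :=
  iteFn_mem_FP (validF_mem_FP hrT) (const_mem_FP _) (const_mem_FP _)

/-- The validity test is one-bit (on every input). [folklore] -/
theorem oneBit_validF (hr1 : OneBit rTest) : OneBit (validF pL rTest pL') := by
  have hl : ∀ (q : Polynomial ℕ) (f : List Bool → List Bool), OneBit (lenLeFn q ∘ f) := fun q f z => by
    rcases lenLeFn_eq_or q (f z) with h | h <;> exact ⟨_, h⟩
  unfold validF
  exact oneBit_andFn (hl _ _) (oneBit_andFn (GSRef.oneBit_hashOkFn.comp _) (oneBit_andFn (hr1.comp _) (hl _ _)))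

/-- **The piece has length at most one** (on every input). [folklore] -/
theorem length_pieceF_le (hr1 : OneBit rTest) (z : List Bool) : (pieceF pL rTest pL' z).length ≤ 1 := by
  obtain ⟨b, hb⟩ := oneBit_validF (pL := pL) (pL' := pL') hr1 z
  unfold pieceF
  rw [iteFn_apply hb]
  cases b <;> simp

end SLB

end Literature.Computability.MetaComplexity
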